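import Summits.KontsevichZagierPeriods.KontsevichZagierPeriods.Theorems.RootDecompWalshStrataOctantDilation

/-!
# The pointless octant, part 2/4: the rational-polar chart

`polPhi (t,s) = (s(1−t²)/(1+t²), 2st/(1+t²))` maps the box `(0,1)²` diffeomorphically onto the open
quarter disc with Jacobian determinant `−2s/(1+t²)` (Euler's rational parametrisation of the circle in
the angle, the radius kept): `of_polRep_sub_of_octDisc_mem_relations :
[(0,1)², c√(1−s²)·2s/(1+t²)] − [quarter disc, c√(1−u²−v²)] ∈ KZ.relations` (rule (2)). Imports:
part 1; 0 sorry. [KontsevichZagier2001 §1.2 rule (2)]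
-/

noncomputable section

open Literature.NumberTheory.Transcendental
open MeasureTheory Set
open MvPolynomial (aeval X C)
open Literature.ModelTheory.ExponentialFields (IsSemialgebraic isSemialgebraic_setOf_eval_pos
  isSemialgebraic_setOf_eval_lt continuous_aeval_real)
open Summit.KontsevichZagierPeriods.RootDecompWalshStrata.WalshSpanProof (isSemialgebraic_cubeSet
  isBounded_cubeSet cellRep cellRep_domain cellRep_integrand)
open Summit.KontsevichZagierPeriods.RootDecompWalshStrata.ConeSpecimen

namespace Summit.KontsevichZagierPeriods.RootDecompWalshStrata.PointlessOctant

/-! #### The rational-polar chart `(t,s) ↦ (s(1−t²)/(1+t²), 2st/(1+t²))` of the quarter disc -/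

/-- The open box `(0,1)²` (coordinates `p 0 = t`, `p 1 = s`). -/
def boxTwo : Set (Fin 2 → ℝ) := {p | ∀ j, 0 < p j ∧ p j < 1}

/-- The box `(0,1)²` is `ℚ`-semialgebraic. [BCR1998 §2.2] -/
theorem isSemialgebraic_boxTwo : IsSemialgebraic ℚ boxTwo := isSemialgebraic_cubeSet 2

/-- The box `(0,1)²` lies in the closed unit square. [folklore] -/
theorem boxTwo_subset_Icc : boxTwo ⊆ Icc 0 1 := fun _ hp =>
  ⟨fun j => (hp j).1.le, fun j => (hp j).2.le⟩

/-- `[(0,1)², c · √(1 − s²) · 2s/(1 + t²)]` — the pull-back of `[quarter disc, c·√(1−u²−v²)]`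
along the rational-polar chart. [KontsevichZagier2001 §1.1] -/
def polRep : KZ.IntegralRep 2 where
  domain := boxTwo
  integrand p := (7 / 64 : ℝ) * √7 * √(1 - p 1 ^ 2) * (2 * p 1 / (1 + p 0 ^ 2))
  isSemialgebraic_domain := isSemialgebraic_boxTwo
  isSemialgebraicFunOn_integrand :=
    (IsSemialgebraicFunOn.mul_holds
      (IsSemialgebraicFunOn.mul_holds (isSemialgebraicFunOn_octConst isSemialgebraic_boxTwo)
        (IsSemialgebraicFunOn.sqrt_holds
          (isSemialgebraicFunOn_aeval isSemialgebraic_boxTwo (1 - X 1 ^ 2))))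
      (isSemialgebraicFunOn_aeval_div_aeval isSemialgebraic_boxTwo (2 * X 1) (1 + X 0 ^ 2)
        fun p _ => by
          have h : (0:ℝ) < 1 + p 0 ^ 2 := by positivity
          simpa using h.ne')).congr fun p _ => by simp
  integrableOn := by
    refine (ContinuousOn.integrableOn_compact isCompact_Icc ?_).mono_set boxTwo_subset_Icc
    have hc : Continuous fun p : Fin 2 → ℝ =>
        (7 / 64 : ℝ) * √7 * √(1 - p 1 ^ 2) * (2 * p 1 / (1 + p 0 ^ 2)) := by
      refine (continuous_const.mul (Real.continuous_sqrt.comp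
        (continuous_const.sub ((continuous_apply 1).pow 2)))).mul (Continuous.div ?_ ?_ fun p => ?_)
      · exact continuous_const.mul (continuous_apply 1)
      · exact continuous_const.add ((continuous_apply 0).pow 2)
      · positivity
    exact hc.continuousOn

/-- The domain of `polRep` (the box `(0,1)²`). [folklore] -/
@[simp] theorem polRep_domain : polRep.domain = boxTwo := rfl

/-- The integrand of `polRep`. [folklore] -/
@[simp] theorem polRep_integrand (p : Fin 2 → ℝ) :
    polRep.integrand p = (7 / 64 : ℝ) * √7 * √(1 - p 1 ^ 2) * (2 * p 1 / (1 + p 0 ^ 2)) := rfl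

/-- The rational-polar chart `Ψ(t,s) = (s(1−t²)/(1+t²), 2st/(1+t²))` (the rational
parametrisation of the circle of radius `s`, `t = tan(θ/2)`). -/
def polPhi (p : Fin 2 → ℝ) : Fin 2 → ℝ :=
  ![p 1 * ((1 - p 0 ^ 2) / (1 + p 0 ^ 2)), p 1 * (2 * p 0 / (1 + p 0 ^ 2))]

/-- First coordinate of the rational-polar chart. [folklore] -/
@[simp] theorem polPhi_zero (p : Fin 2 → ℝ) : polPhi p 0 = p 1 * ((1 - p 0 ^ 2) / (1 + p 0 ^ 2)) := rfl

/-- Second coordinate of the rational-polar chart. [folklore] -/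
@[simp] theorem polPhi_one (p : Fin 2 → ℝ) : polPhi p 1 = p 1 * (2 * p 0 / (1 + p 0 ^ 2)) := rfl

/-- The Jacobian matrix of `Ψ` (rows `u, v`; columns `t, s`). -/
def polMat (p : Fin 2 → ℝ) : Matrix (Fin 2) (Fin 2) ℝ :=
  !![p 1 * (-(4 * p 0) / (1 + p 0 ^ 2) ^ 2), (1 - p 0 ^ 2) / (1 + p 0 ^ 2);
     p 1 * (2 * (1 - p 0 ^ 2) / (1 + p 0 ^ 2) ^ 2), 2 * p 0 / (1 + p 0 ^ 2)]

/-- The derivative of `Ψ` at `p` as a continuous linear map. -/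
def polPhi' (p : Fin 2 → ℝ) : (Fin 2 → ℝ) →L[ℝ] (Fin 2 → ℝ) :=
  LinearMap.toContinuousLinearMap (Matrix.toLin' (polMat p))

/-- Matrix form of `polPhi'`. [folklore] -/
theorem polPhi'_apply (p v : Fin 2 → ℝ) (a : Fin 2) :
    polPhi' p v a = ∑ b, polMat p a b * v b := by
  change Matrix.toLin' (polMat p) v a = _
  rw [Matrix.toLin'_apply]
  rfl

/-- `det Ψ'(t,s) = −2s/(1+t²)`. -/
theorem polPhi'_det (p : Fin 2 → ℝ) : (polPhi' p).det = -(2 * p 1) / (1 + p 0 ^ 2) := by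
  change LinearMap.det (Matrix.toLin' (polMat p)) = _
  rw [LinearMap.det_toLin', Matrix.det_fin_two]
  simp only [polMat, Matrix.of_apply, Matrix.cons_val', Matrix.cons_val_zero, Matrix.cons_val_one,
    Matrix.cons_val_fin_one, Matrix.empty_val']
  have h : (1 + p 0 ^ 2) ≠ 0 := by positivity
  field_simp
  ring

/-- `Ψ` is differentiable with derivative `Ψ'`. -/
theorem hasFDerivAt_polPhi (p : Fin 2 → ℝ) : HasFDerivAt polPhi (polPhi' p) p := by
  have hπ0 : HasFDerivAt (𝕜 := ℝ) (fun y : Fin 2 → ℝ => y 0)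
      (ContinuousLinearMap.proj (R := ℝ) (φ := fun _ : Fin 2 => ℝ) 0) p := hasFDerivAt_apply 0 p
  have hπ1 : HasFDerivAt (𝕜 := ℝ) (fun y : Fin 2 → ℝ => y 1)
      (ContinuousLinearMap.proj (R := ℝ) (φ := fun _ : Fin 2 => ℝ) 1) p := hasFDerivAt_apply 1 p
  have hE : HasFDerivAt (fun y : Fin 2 → ℝ => (1 - y 0 ^ 2) / (1 + y 0 ^ 2))
      ((-(4 * p 0) / (1 + p 0 ^ 2) ^ 2) •
        ContinuousLinearMap.proj (R := ℝ) (φ := fun _ : Fin 2 => ℝ) 0) p :=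
    HasDerivAt.comp_hasFDerivAt (h₂ := fun s : ℝ => (1 - s ^ 2) / (1 + s ^ 2)) p
      (by
        -- `d/ds (1 − s²)/(1 + s²) = −4s/(1+s²)²` (inlined; the landed twins live in farm-unbuilt modules)
        have h1 : HasDerivAt (fun s : ℝ => 1 - s ^ 2) (-(2 * p 0)) (p 0) := by
          simpa using (hasDerivAt_pow 2 (p 0)).const_sub 1
        have h2 : HasDerivAt (fun s : ℝ => 1 + s ^ 2) (2 * p 0) (p 0) := by
          simpa using (hasDerivAt_pow 2 (p 0)).const_add 1
        have hne : (1 + p 0 ^ 2) ≠ 0 := by positivity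
        exact (h1.div h2 hne).congr_deriv (by field_simp; ring)) hπ0
  have hT : HasFDerivAt (fun y : Fin 2 → ℝ => 2 * y 0 / (1 + y 0 ^ 2))
      ((2 * (1 - p 0 ^ 2) / (1 + p 0 ^ 2) ^ 2) •
        ContinuousLinearMap.proj (R := ℝ) (φ := fun _ : Fin 2 => ℝ) 0) p :=
    HasDerivAt.comp_hasFDerivAt (h₂ := fun s : ℝ => 2 * s / (1 + s ^ 2)) p
      (by
        -- `d/dt 2t/(1+t²) = 2(1−t²)/(1+t²)²` (inlined; the landed twin lives in a farm-unbuilt module)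
        have h1 : HasDerivAt (fun s : ℝ => 2 * s) 2 (p 0) := by
          simpa using (hasDerivAt_id (p 0)).const_mul (2:ℝ)
        have h2 : HasDerivAt (fun s : ℝ => 1 + s ^ 2) (2 * p 0) (p 0) := by
          simpa using (hasDerivAt_pow 2 (p 0)).const_add 1
        have hne : (1 + p 0 ^ 2) ≠ 0 := by positivity
        exact (h1.div h2 hne).congr_deriv (by field_simp; ring)) hπ0
  have h0 : HasFDerivAt (fun y : Fin 2 → ℝ => polPhi y 0)
      ((ContinuousLinearMap.proj 0).comp (polPhi' p)) p := by
    have hf : (fun y : Fin 2 → ℝ => polPhi y 0) = fun y => y 1 * ((1 - y 0 ^ 2) / (1 + y 0 ^ 2)) :=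
      funext polPhi_zero
    rw [hf]
    refine (hπ1.mul hE).congr_fderiv (ContinuousLinearMap.ext fun v => ?_)
    simp [polPhi'_apply, polMat, Fin.sum_univ_two, smul_eq_mul]
    ring
  have h1 : HasFDerivAt (fun y : Fin 2 → ℝ => polPhi y 1)
      ((ContinuousLinearMap.proj 1).comp (polPhi' p)) p := by
    have hf : (fun y : Fin 2 → ℝ => polPhi y 1) = fun y => y 1 * (2 * y 0 / (1 + y 0 ^ 2)) :=
      funext polPhi_one
    rw [hf]
    refine (hπ1.mul hT).congr_fderiv (ContinuousLinearMap.ext fun v => ?_)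
    simp [polPhi'_apply, polMat, Fin.sum_univ_two, smul_eq_mul]
    ring
  refine hasFDerivAt_pi'' fun a => ?_
  fin_cases a
  · exact h0
  · exact h1

/-- `u² + v² = s²` along the chart. -/
theorem polPhi_normSq (p : Fin 2 → ℝ) : polPhi p 0 ^ 2 + polPhi p 1 ^ 2 = p 1 ^ 2 := by
  simp only [polPhi_zero, polPhi_one]
  have h : (1 + p 0 ^ 2) ≠ 0 := by positivity
  field_simp
  ring

/-- `t ↦ (1−t²)/(1+t²)` is injective on `t > 0`. -/
theorem euler_inj {a b : ℝ} (ha : 0 < a) (hb : 0 < b)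
    (h : (1 - a ^ 2) / (1 + a ^ 2) = (1 - b ^ 2) / (1 + b ^ 2)) : a = b := by
  have ha1 : (0:ℝ) < 1 + a ^ 2 := by positivity
  have hb1 : (0:ℝ) < 1 + b ^ 2 := by positivity
  rw [div_eq_div_iff ha1.ne' hb1.ne'] at h
  have hsq : a ^ 2 = b ^ 2 := by nlinarith
  exact (pow_left_inj₀ ha.le hb.le two_ne_zero).1 hsq

/-- `Ψ` is injective on the box `(0,1)²`. -/
theorem injOn_polPhi : InjOn polPhi boxTwo := by
  intro x hx y hy hxy
  have hx0 := hx 0; have hx1 := hx 1; have hy0 := hy 0; have hy1 := hy 1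
  have hs : x 1 = y 1 := by
    have h := polPhi_normSq x
    rw [hxy, polPhi_normSq y] at h
    exact ((pow_left_inj₀ hx1.1.le hy1.1.le two_ne_zero).1 h.symm)
  have ht : x 0 = y 0 := by
    have h := congrFun hxy 0
    simp only [polPhi_zero, hs] at h
    exact euler_inj hx0.1 hy0.1 (mul_left_cancel₀ hy1.1.ne' h)
  funext j
  fin_cases j
  · exact ht
  · exact hs

/-- `Ψ` maps the box `(0,1)²` onto the open quarter disc. -/
theorem image_polPhi : polPhi '' boxTwo = discBase := by
  ext u
  simp only [mem_image, discBase, mem_setOf_eq, aeval_discPoly]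
  constructor
  · rintro ⟨p, hp, rfl⟩
    have hp0 := hp 0; have hp1 := hp 1
    have h1 : (0:ℝ) < 1 + p 0 ^ 2 := by positivity
    have hE0 : 0 < (1 - p 0 ^ 2) / (1 + p 0 ^ 2) := div_pos (by nlinarith) h1
    have hE1 : (1 - p 0 ^ 2) / (1 + p 0 ^ 2) ≤ 1 := (div_le_one h1).2 (by nlinarith)
    have hT0 : 0 < 2 * p 0 / (1 + p 0 ^ 2) := div_pos (by linarith) h1
    have hT1 : 2 * p 0 / (1 + p 0 ^ 2) ≤ 1 := (div_le_one h1).2 (by nlinarith)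
    refine ⟨fun j => ?_, ?_⟩
    · fin_cases j
      · exact ⟨by simpa using mul_pos hp1.1 hE0,
          by simpa using mul_lt_one_of_nonneg_of_lt_one_left hp1.1.le hp1.2 hE1⟩
      · exact ⟨by simpa using mul_pos hp1.1 hT0,
          by simpa using mul_lt_one_of_nonneg_of_lt_one_left hp1.1.le hp1.2 hT1⟩
    · have h := polPhi_normSq p
      simp only [polPhi_zero, polPhi_one] at h
      simp only [polPhi_zero, polPhi_one]
      nlinarith [hp1.1, hp1.2]
  · rintro ⟨hu, hd⟩
    have hu0 := hu 0; have hu1 := hu 1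
    -- `s = √(u²+v²)`, `t = v/(s+u)`
    set S : ℝ := √(u 0 ^ 2 + u 1 ^ 2) with hS_def
    have hS2 : S ^ 2 = u 0 ^ 2 + u 1 ^ 2 := Real.sq_sqrt (by positivity)
    have hSpos : 0 < S := Real.sqrt_pos.2 (by have h := hu0.1; positivity)
    have hSne : S ≠ 0 := hSpos.ne'
    have hSlt : S < 1 := (Real.sqrt_lt' one_pos).2 (by linarith)
    have hvS : u 1 ≤ S := by nlinarith [sq_nonneg (u 0), hu1.1]
    have hSu : 0 < S + u 0 := by linarith [hu0.1]
    have hSune : S + u 0 ≠ 0 := hSu.ne'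
    have hT0 : 0 < u 1 / (S + u 0) := div_pos hu1.1 hSu
    have hT1 : u 1 / (S + u 0) < 1 := (div_lt_one hSu).2 (by linarith [hu0.1])
    have hq2 : 1 + (u 1 / (S + u 0)) ^ 2 = 2 * S / (S + u 0) := by
      field_simp
      linear_combination (-1:ℝ) * hS2
    have hq1 : 1 - (u 1 / (S + u 0)) ^ 2 = 2 * u 0 / (S + u 0) := by
      field_simp
      linear_combination hS2
    have e0 : polPhi ![u 1 / (S + u 0), S] 0 = u 0 := by
      show S * ((1 - (u 1 / (S + u 0)) ^ 2) / (1 + (u 1 / (S + u 0)) ^ 2)) = u 0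
      rw [hq1, hq2]
      field_simp
    have e1 : polPhi ![u 1 / (S + u 0), S] 1 = u 1 := by
      show S * (2 * (u 1 / (S + u 0)) / (1 + (u 1 / (S + u 0)) ^ 2)) = u 1
      rw [hq2]
      field_simp
    refine ⟨![u 1 / (S + u 0), S], fun j => ?_, ?_⟩
    · fin_cases j
      · exact ⟨by simpa using hT0, by simpa using hT1⟩
      · exact ⟨by simpa using hSpos, by simpa using hSlt⟩
    · funext j
      fin_cases j
      · exact e0
      · exact e1

/-- **Move (2), the rational-polar chart:** `[(0,1)², c·√(1−s²)·2s/(1+t²)] − [quarter disc,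
c·√(1−u²−v²)] ∈ relations` (`u² + v² = s²`, `|det Ψ'| = 2s/(1+t²)`).
[KontsevichZagier2001 §1.2 rule (2)] -/
theorem of_polRep_sub_of_octDisc_mem_relations :
    KZ.of polRep - KZ.of octDisc ∈ KZ.relations := by
  refine KZ.changeOfVariablesRel_subset_relations
    ⟨2, polRep, octDisc, polPhi, polPhi', ?_,
      fun p _ => (hasFDerivAt_polPhi p).hasFDerivWithinAt, injOn_polPhi, ?_, fun p hp => ?_, rfl⟩
  · refine IsSemialgebraicMapOn.of_forall isSemialgebraic_boxTwo fun j => ?_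
    fin_cases j
    · exact (IsSemialgebraicFunOn.mul_holds (isSemialgebraicFunOn_aeval isSemialgebraic_boxTwo (X 1))
        (isSemialgebraicFunOn_aeval_div_aeval isSemialgebraic_boxTwo (1 - X 0 ^ 2) (1 + X 0 ^ 2)
          fun p _ => by
            have h : (0:ℝ) < 1 + p 0 ^ 2 := by positivity
            simpa using h.ne')).congr fun p _ => by simp
    · exact (IsSemialgebraicFunOn.mul_holds (isSemialgebraicFunOn_aeval isSemialgebraic_boxTwo (X 1))
        (isSemialgebraicFunOn_aeval_div_aeval isSemialgebraic_boxTwo (2 * X 0) (1 + X 0 ^ 2)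
          fun p _ => by
            have h : (0:ℝ) < 1 + p 0 ^ 2 := by positivity
            simpa using h.ne')).congr fun p _ => by simp
  · rw [octDisc_domain, polRep_domain, image_polPhi]
  · have hp0 := hp 0; have hp1 := hp 1
    have h1 : (0:ℝ) < 1 + p 0 ^ 2 := by positivity
    have hdet : (polPhi' p).det < 0 := by
      rw [polPhi'_det]
      exact div_neg_of_neg_of_pos (by linarith [hp1.1]) h1
    rw [polRep_integrand, octDisc_integrand, abs_of_neg hdet, polPhi'_det]
    have hsq : 1 - polPhi p 0 ^ 2 - polPhi p 1 ^ 2 = 1 - p 1 ^ 2 := by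
      have := polPhi_normSq p; linarith
    rw [hsq]
    field_simp


end Summit.KontsevichZagierPeriods.RootDecompWalshStrata.PointlessOctant

end
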